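import Mathlib.GroupTheory.Sylow
import Mathlib.GroupTheory.Commutator.Basic
import Summits.MatrixMultiplication.OmegaCensus.BoxUsefulOddSylowAbelian

/-!
# ω-census, family (b3): conjecture C9 (b) — second-central elements of a box-useful group: commutator calculus and the odd part

HONEST FRAMING (pub-omega census; verbatim): lottery ticket; floor = certified bounds/negative ranges.
Census BOOKKEEPING (conjecture C9 of the cell, STRUCTURE.md §2; pub-omega kernel-l4 gen 16, task K-5, structure part).  An
element `u ∈ G` is *second-central* when all its commutators `⁅u, g⁆ = u g u⁻¹ g⁻¹` are central (`u ∈ Z₂(G)`).  For such `u`: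
`g ↦ ⁅u, g⁆` is multiplicative, `⁅u^n, g⁆ = ⁅u, g⁆^n = ⁅u, g^n⁆`, so `orderOf ⁅u, g⁆` divides `orderOf u` and `orderOf g`
(`SecondCentre.*`).  **Theorem (`SecondCentre.mem_center_of_orderOf_odd_prime_pow`).** In a box-useful finite group every
second-central element of order `p^k` with `p` an ODD prime is central.  *Proof:* for any `g`, `⁅u, g⁆` has order dividing
`p^k`; the `p'`-part of `orderOf g` kills it by coprimality, and the `p`-part because the `p`-power `g^m` lies in a Sylow
`p`-subgroup, which is conjugate to one containing `u`, contains a central translate `w u` of `u` and is ABELIAN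
(`OddPGroup.sylow_comm_of_boxUseful`) — so `g^m` commutes with `u`.  Hence `Z₂(G)/Z(G)` is a `2`-group for box-useful `G`;
this is the first step of the centre-lifting theorem (`BoxUsefulCentreLift`).  Nothing here is progress on `ω`.
-/

namespace Summit.MatrixMultiplication.OmegaCensus

open Finset ProductBoxBound
open scoped commutatorElement

namespace SecondCentre

variable {G : Type*} [Group G] {u : G}

/-- The conjugation rule `u g = ⁅u,g⁆ g u`. [folklore] -/
theorem conj_eq (u g : G) : u * g = ⁅u, g⁆ * g * u := by rw [commutatorElement_def]; group

/-- For second-central `u`, `g ↦ ⁅u, g⁆` is multiplicative. [folklore] -/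
theorem comm_mul (hu : ∀ g : G, ⁅u, g⁆ ∈ Subgroup.center G) (g h : G) : ⁅u, g * h⁆ = ⁅u, g⁆ * ⁅u, h⁆ := by
  have hc : g * ⁅u, h⁆ = ⁅u, h⁆ * g := (Subgroup.mem_center_iff.mp (hu h) g)
  simp only [commutatorElement_def] at hc ⊢
  calc u * (g * h) * u⁻¹ * (g * h)⁻¹ = (u * g * u⁻¹ * g⁻¹) * (g * (u * h * u⁻¹ * h⁻¹) * g⁻¹) := by group
    _ = (u * g * u⁻¹ * g⁻¹) * (u * h * u⁻¹ * h⁻¹) := by rw [hc]; group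

/-- `⁅u, g^n⁆ = ⁅u, g⁆^n`. [folklore] -/
theorem comm_pow_right (hu : ∀ g : G, ⁅u, g⁆ ∈ Subgroup.center G) (g : G) (n : ℕ) : ⁅u, g ^ n⁆ = ⁅u, g⁆ ^ n := by
  induction n with
  | zero => simp
  | succ n ih => rw [pow_succ, comm_mul hu, ih, pow_succ]

/-- `⁅u^n, g⁆ = ⁅u, g⁆^n`. [folklore] -/
theorem comm_pow_left (hu : ∀ g : G, ⁅u, g⁆ ∈ Subgroup.center G) (g : G) (n : ℕ) : ⁅u ^ n, g⁆ = ⁅u, g⁆ ^ n := by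
  -- `u^n g = ⁅u,g⁆^n g u^n`
  have key : ∀ n : ℕ, u ^ n * g = ⁅u, g⁆ ^ n * g * u ^ n := by
    intro n
    induction n with
    | zero => simp
    | succ n ih =>
      have hzn : u * ⁅u, g⁆ ^ n = ⁅u, g⁆ ^ n * u :=
        Subgroup.mem_center_iff.mp (Subgroup.pow_mem _ (hu g) n) u
      calc u ^ (n + 1) * g = u * (u ^ n * g) := by rw [pow_succ']; group
        _ = u * (⁅u, g⁆ ^ n * g * u ^ n) := by rw [ih]
        _ = (u * ⁅u, g⁆ ^ n) * g * u ^ n := by group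
        _ = (⁅u, g⁆ ^ n * u) * g * u ^ n := by rw [hzn]
        _ = ⁅u, g⁆ ^ n * (u * g) * u ^ n := by group
        _ = ⁅u, g⁆ ^ n * (⁅u, g⁆ * g * u) * u ^ n := by rw [conj_eq u g]
        _ = ⁅u, g⁆ ^ (n + 1) * g * u ^ (n + 1) := by rw [pow_succ, pow_succ]; group
  rw [commutatorElement_def]
  calc u ^ n * g * (u ^ n)⁻¹ * g⁻¹ = (⁅u, g⁆ ^ n * g * u ^ n) * (u ^ n)⁻¹ * g⁻¹ := by rw [key]
    _ = ⁅u, g⁆ ^ n := by group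

/-- `orderOf ⁅u, g⁆ ∣ orderOf u`. [folklore] -/
theorem orderOf_comm_dvd_left (hu : ∀ g : G, ⁅u, g⁆ ∈ Subgroup.center G) (g : G) : orderOf ⁅u, g⁆ ∣ orderOf u := by
  apply orderOf_dvd_of_pow_eq_one
  rw [← comm_pow_left hu, pow_orderOf_eq_one, commutatorElement_def]; group

/-- `orderOf ⁅u, g⁆ ∣ orderOf g`. [folklore] -/
theorem orderOf_comm_dvd_right (hu : ∀ g : G, ⁅u, g⁆ ∈ Subgroup.center G) (g : G) : orderOf ⁅u, g⁆ ∣ orderOf g := by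
  apply orderOf_dvd_of_pow_eq_one
  rw [← comm_pow_right hu, pow_orderOf_eq_one, commutatorElement_def]; group

/-- Second-central elements commute with every element of coprime order. [folklore] -/
theorem comm_eq_one_of_coprime (hu : ∀ g : G, ⁅u, g⁆ ∈ Subgroup.center G) {g : G}
    (hcop : (orderOf u).Coprime (orderOf g)) : ⁅u, g⁆ = 1 := by
  rw [← orderOf_eq_one_iff]
  exact Nat.eq_one_of_dvd_coprimes hcop (orderOf_comm_dvd_left hu g) (orderOf_comm_dvd_right hu g)

/-- `⁅u, g⁆ = 1 ↔ u g = g u`. [folklore] -/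
theorem comm_eq_one_iff (u g : G) : ⁅u, g⁆ = 1 ↔ u * g = g * u := by
  rw [commutatorElement_def]
  constructor
  · intro h; calc u * g = u * g * u⁻¹ * g⁻¹ * (g * u) := by group
      _ = g * u := by rw [h, one_mul]
  · intro h; rw [h]; group

/-- A conjugate of a second-central element is a central translate of it. [folklore] -/
theorem conj_eq_central_mul (hu : ∀ g : G, ⁅u, g⁆ ∈ Subgroup.center G) (x : G) :
    ∃ w ∈ Subgroup.center G, x * u * x⁻¹ = w * u := by
  refine ⟨⁅u, x⁆⁻¹, Subgroup.inv_mem _ (hu x), ?_⟩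
  rw [commutatorElement_def]; group

/-- Conjugation preserves being second-central (with the same set of commutator values up to inverse). [folklore] -/
theorem conj_secondCentral (hu : ∀ g : G, ⁅u, g⁆ ∈ Subgroup.center G) (x g : G) : ⁅x * u * x⁻¹, g⁆ ∈ Subgroup.center G := by
  obtain ⟨w, hw, e⟩ := conj_eq_central_mul hu x
  rw [e]
  have : ⁅w * u, g⁆ = ⁅u, g⁆ := by
    have hwc := Subgroup.mem_center_iff.mp hw
    rw [commutatorElement_def, commutatorElement_def]
    calc w * u * g * (w * u)⁻¹ * g⁻¹ = w * u * g * u⁻¹ * (w⁻¹ * g⁻¹) := by group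
      _ = w * u * g * u⁻¹ * (g⁻¹ * w⁻¹) := by
          congr 1; rw [← mul_inv_rev, ← mul_inv_rev, hwc]
      _ = w * (u * g * u⁻¹ * g⁻¹) * w⁻¹ := by group
      _ = u * g * u⁻¹ * g⁻¹ := by rw [← hwc]; group
  rw [this]; exact hu g

variable [Fintype G] [DecidableEq G]

/-- **Second-central elements of odd prime-power order are central in a box-useful group.** [folklore] -/
theorem mem_center_of_orderOf_odd_prime_pow (hG : BoxUseful G) {p : ℕ} [hp : Fact p.Prime] (hodd : Odd p)
    (hu : ∀ g : G, ⁅u, g⁆ ∈ Subgroup.center G) {k : ℕ} (hord : orderOf u = p ^ k) : u ∈ Subgroup.center G := by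
  classical
  rw [Subgroup.mem_center_iff]
  intro g
  -- it suffices that `⁅u, g⁆ = 1`
  suffices h : ⁅u, g⁆ = 1 by exact ((comm_eq_one_iff u g).1 h).symm
  -- decompose `orderOf g = p^a * m` with `p ∤ m`
  obtain ⟨a, m, hm, hn⟩ := Nat.exists_eq_pow_mul_and_not_dvd (orderOf_pos g).ne' p hp.out.ne_one
  -- the commutator has order dividing `p^k`, `p^a * m`; we show it divides `m` and `p^a` separately... via the two powers
  have hz := hu g
  have hdvd_u : orderOf ⁅u, g⁆ ∣ p ^ k := hord ▸ orderOf_comm_dvd_left hu g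
  -- (1) `⁅u, g^m⁆ = 1`: `g^m` is a `p`-element, lies in a Sylow `p`-subgroup conjugate to one containing `u`
  have h1 : ⁅u, g ^ m⁆ = 1 := by
    have hgm : (g ^ m) ^ p ^ a = 1 := by rw [← pow_mul, mul_comm, ← hn]; exact pow_orderOf_eq_one g
    have hPg : IsPGroup p (Subgroup.zpowers (g ^ m)) := by
      obtain ⟨j, -, hj⟩ := (Nat.dvd_prime_pow hp.out).1 (orderOf_dvd_of_pow_eq_one hgm)
      exact IsPGroup.of_card (by rw [Nat.card_zpowers, hj])
    have hPu : IsPGroup p (Subgroup.zpowers u) := IsPGroup.of_card (by rw [Nat.card_zpowers, hord])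
    obtain ⟨Q, hQ⟩ := hPg.exists_le_sylow
    obtain ⟨P, hP⟩ := hPu.exists_le_sylow
    obtain ⟨x, hx⟩ := MulAction.exists_smul_eq G P Q
    have hxu : x * u * x⁻¹ ∈ (Q : Subgroup G) := by
      have e : ((x • P : Sylow p G) : Subgroup G) = (Q : Subgroup G) := congrArg (fun R : Sylow p G => (R : Subgroup G)) hx
      rw [Sylow.coe_subgroup_smul] at e
      rw [← e]
      have := Subgroup.smul_mem_pointwise_smul u (MulAut.conj x) (P : Subgroup G) (hP (Subgroup.mem_zpowers u))
      simpa [MulAut.smul_def, MulAut.conj_apply] using this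
    obtain ⟨w, hw, hwu⟩ := conj_eq_central_mul hu x
    have hgQ : g ^ m ∈ (Q : Subgroup G) := hQ (Subgroup.mem_zpowers _)
    -- `Q` is abelian
    have hcomm : (g ^ m) * (x * u * x⁻¹) = (x * u * x⁻¹) * (g ^ m) :=
      OddPGroup.sylow_comm_of_boxUseful hodd hG Q _ _ hgQ hxu
    rw [hwu] at hcomm
    have hwc := Subgroup.mem_center_iff.mp hw
    -- cancel the central `w`
    have : g ^ m * u = u * g ^ m := by
      have e1 : g ^ m * (w * u) = w * (g ^ m * u) := by rw [← mul_assoc, hwc (g ^ m), mul_assoc]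
      rw [e1, mul_assoc] at hcomm
      exact mul_left_cancel hcomm
    exact (comm_eq_one_iff u (g ^ m)).2 this.symm
  -- (2) `⁅u, g^(p^a)⁆ = 1` by coprimality of orders
  have h2 : ⁅u, g ^ p ^ a⁆ = 1 := by
    apply comm_eq_one_of_coprime hu
    rw [hord]
    have ho : orderOf (g ^ p ^ a) = m := by
      rw [orderOf_pow' g (pow_ne_zero _ hp.out.ne_zero), hn, Nat.gcd_eq_right (Dvd.intro m rfl),
        Nat.mul_div_cancel_left m (Nat.pos_of_ne_zero (pow_ne_zero _ hp.out.ne_zero))]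
    rw [ho]
    exact Nat.Coprime.pow_left k ((Nat.Prime.coprime_iff_not_dvd hp.out).mpr hm)
  -- (3) combine: the order of `⁅u,g⁆` divides `m` and `p^a`
  have hdm : orderOf ⁅u, g⁆ ∣ m := by
    apply orderOf_dvd_of_pow_eq_one; rw [← comm_pow_right hu, h1]
  have hdp : orderOf ⁅u, g⁆ ∣ p ^ a := by
    apply orderOf_dvd_of_pow_eq_one; rw [← comm_pow_right hu, h2]
  have hcop : Nat.Coprime (p ^ a) m := Nat.Coprime.pow_left a ((Nat.Prime.coprime_iff_not_dvd hp.out).mpr hm)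
  rw [← orderOf_eq_one_iff]
  exact Nat.eq_one_of_dvd_coprimes hcop hdp hdm

end SecondCentre

end Summit.MatrixMultiplication.OmegaCensus
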